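import Mathlib
import HarnessLib
import Summits.HubbardSuperconductivity.HubbardSuperconductivity.Theorems.KLProgrammeC4aTubeTadpole
import Summits.HubbardSuperconductivity.HubbardSuperconductivity.Theorems.KLProgrammePolarRayCoareaJacobianFrame

/-!
# Route `KLProgramme` — crux C4a, value layer (k = 0): the RADIAL ROW of the co-moving chart's Jacobian — the level density
# `N_K(ρ) = ∫_{(0,2π]} J(ρ,ϑ) dϑ` is Lipschitz in the level (the `hJ` input of the Hartree value theorem), and the Jacobian half of the
# (L3-val) odd-difference dominator for a general vertex

Cell `gate-hubbard-kl`, lane hubbard-kl-k3c3-p3 (g10, row «implicit-function / monotonicity route for μ(n)», Jacobian-certificate lineage);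
helper for the engine-flow child `KLRegimeEngineV17F2` (stmt-HubbardSuperconductivity-20437), stub (C) `stub_twoLeg_curvature`, k = 0 VALUE clause
(located risk #12 «(C)-VALUE-K0», KL STATUS l.3800; the datum asked of this lineage at l.3794 / C4A-PLAN §17.5: «a RADIAL row — `|∂_ρ levelChartJac|`
or directly the odd-difference of the level density `|N_K(ρ) − N_K(−ρ)| ≤ dJ·|ρ|` — it prices the Hartree VALUE»).

WHAT IS PROVED.  Under exactly the hypotheses of `…C4aTubeTadpole` / `…C4aTubeTadpoleValue` §3–§4 (`B : BandBounds a b`, a frame `K` of `C²`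
size `A` with `2A < Dt_min`, a level window `[μ − r − A, μ + r + A] ⊂ (a, b)`), with the closed-form constant
  `jacR = 1/(Dt_min − 2A)² + π√2·(2 + 4A)/(Dt_min − 2A)³`
(window-uniform through `Dt_min`, frame-uniform through `A`; e.g. `Dt_min = 0.6585`, `A → 0`: `jacR ≤ 33.5`; NO certified table is needed):
* §1 `levelChartJac_eq_radius_mul_inv_slope`: on the tube the Jacobian weight IS k3c2-p2's level-set Jacobian
  `𝒥(ϑ, ν) = u_K(ν;ϑ)·(∂_tε₀(ϑ,u) + Dδ_K(u·dir ϑ)[dir ϑ])⁻¹` at `ν = μ + ρ` (`∂_μ u = 1/(∂_tε₀ + Dδ_K[dir])`, `hasDerivAt_perturbedFermiRadius_level`);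
* §2 **`abs_levelChartJac_sub_le`** — the radial row, pointwise and DERIVATIVE-FREE: for `ρ, ρ' ∈ (−r, r)` and every `ϑ`,
  `|J(ρ,ϑ) − J(ρ',ϑ)| ≤ jacR·|ρ − ρ'|` (k3c2-p2's `klrj_jacobian_lipschitz` with its radial input `κ₂ = 4A` discharged by
  `klrk_radial_fderiv_lipschitz` ∘ `frameShift_toLp_small`: `u` is `1/(Dt−2A)`-Lipschitz in the level, `∂_tε₀` is `2`-Lipschitz, `Dδ_K[dir]` is
  `4A`-Lipschitz along rays, `u ≤ π√2`); the same number bounds `|∂_ρ J(ρ,ϑ)|` on the tube (`abs_deriv_levelChartJac_radial_le`, the datum's other spelling);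
* §3 **`abs_levelDensity_sub_le`** / **`abs_levelDensity_sub_neg_le`**: `|N_K(ρ) − N_K(ρ')| ≤ 2π·jacR·|ρ − ρ'|` and the odd-difference form
  `|N_K(ρ) − N_K(−ρ)| ≤ 4π·jacR·|ρ|` — LITERALLY the hypothesis `hJ` of `…C4aTubeTadpoleValue.norm_tubeTadpole_const_le` with `dJ ρ = 4π·jacR·|ρ|`
  (so the Hartree value is `≤ 2π·jacR·‖c‖·∫_{(−r,r)} ‖f(ρ)‖·|ρ| dρ`, the first radial MOMENT of the slice `≍ Λ_n²`; instantiated in the companion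
  `…C4aLevelDensityRadialValue`);
* §4 **`norm_setIntegral_jac_smul_sub_le`** — the JACOBIAN HALF of (L3-val) for a general (fat) vertex pair `Vp, Vm`: if `‖Vp(Φ(0,θ),Φ(ρ,ϑ))‖ ≤ M` on
  the level circle and the vertex's own radial odd-difference along the chart is dominated, `‖Vp(Φ(0,θ),Φ(ρ,ϑ)) − Vm(Φ(0,θ),Φ(−ρ,ϑ))‖ ≤ e(ϑ)`, then
  `‖∫ J(ρ,ϑ)•Vp dϑ − ∫ J(−ρ,ϑ)•Vm dϑ‖ ≤ 4π·jacR·|ρ|·M + (π√2/(Dt_min − 2A))·∫_{(0,2π]} e` — the dominator `hd` of `norm_tubeTadpole_pair_le` /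
  `norm_tubeTadpole_le_of_odd` modulo ONLY the vertex's `e` (C4A-PLAN §17.3's physics), the Jacobian's share discharged here.
Pure calculus on the tree's objects; nothing is asserted about the Hubbard model.  References: BGM 2006 §2.4 Lemma 2.1 (2.40)–(2.41)
[cite: BenfattoGiulianiMastropietro2006]; FST II CPAM 51 (1998) 1133 (H2)(2).
-/

noncomputable section

namespace Summit.HubbardSuperconductivity.HubbardSuperconductivity.Theorems.C4a

set_option linter.dupNamespace false -- summit = problem name (single-conjunct summit), D-0017

open Real Set MeasureTheory Filter
open scoped ContDiff Topology
open Literature.MathematicalPhysics.QuantumLattice Literature.MathematicalPhysics.QuantumLattice.BandSectorCounting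
open Summit.HubbardSuperconductivity.HubbardSuperconductivity.Theorems.DispersionFlow
open Summit.HubbardSuperconductivity.HubbardSuperconductivity.Theorems.KLRegimeSplit
open Summit.HubbardSuperconductivity.HubbardSuperconductivity.Theorems.PerturbedFermiCurve

section Radial

variable {a b : ℝ} (B : BandBounds a b) {K : TrigPolyC4v} {A : ℝ}
  (hA : ∀ p : Momentum, ∀ j ≤ 2, ‖iteratedFDeriv ℝ j (frameShift K) p‖ ≤ A) (hADt : 2 * A < B.Dtmin)
  {μ r : ℝ} (hlo : a < μ - r - A) (hhi : μ + r + A < b)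
include B hA hADt hlo hhi

/-! ## §1 The Jacobian weight is the level-set Jacobian `u·(∂_tε₀ + Dδ_K[dir])⁻¹` -/

/-- **`J = u/D` on the tube**: for `|ρ| < r`, `levelChartJac μ K (ρ, ϑ) = u·(∂_tε₀(ϑ, u) + Dδ_K(u·dir ϑ)[dir ϑ])⁻¹` with
`u = u_K(μ + ρ; ϑ)`, `δ_K = (k ↦ −K(k))` (the level derivative `∂_μ u` computed by `hasDerivAt_perturbedFermiRadius_level`). -/
theorem levelChartJac_eq_radius_mul_inv_slope {ρ : ℝ} (hρ : ρ ∈ Ioo (-r) r) (ϑ : ℝ) :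
    levelChartJac μ K (ρ, ϑ) =
      perturbedFermiRadius (fun k : Fin 2 → ℝ => -K.eval k) (μ + ρ) ϑ *
        (rayDispersionDt ϑ (perturbedFermiRadius (fun k : Fin 2 → ℝ => -K.eval k) (μ + ρ) ϑ) +
          fderiv ℝ (fun k : Fin 2 → ℝ => -K.eval k)
            (perturbedFermiRadius (fun k : Fin 2 → ℝ => -K.eval k) (μ + ρ) ϑ • dir ϑ) (dir ϑ))⁻¹ := by
  have hC : ContDiff ℝ ((⊤ : ℕ∞) : WithTop ℕ∞) (fun k : Fin 2 → ℝ => -K.eval k) := by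
    rw [← frameShift_toLp_eq_neg_eval]; exact contDiff_frameShift_toLp K
  have hδ : ∀ k : Fin 2 → ℝ, (∀ i, |k i| ≤ π) → |(fun q : Fin 2 → ℝ => -K.eval q) k| ≤ A := fun k _ => by
    simpa [frameShift_toLp] using abs_frameShift_toLp_le hA k
  have hκ : ∀ k : Fin 2 → ℝ, (∀ i, |k i| ≤ π) → ‖fderiv ℝ (fun q : Fin 2 → ℝ => -K.eval q) k‖ ≤ 2 * A := fun k _ => by
    rw [← frameShift_toLp_eq_neg_eval]; exact norm_fderiv_frameShift_toLp_le hA k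
  have h1 : a < μ + ρ - A := by have := hρ.1; linarith
  have h2 : μ + ρ + A < b := by have := hρ.2; linarith
  rw [levelChartJac_apply,
    (hasDerivAt_perturbedFermiRadius_level B hC (by simp) hδ hκ hADt (μ₀ := μ + ρ) h1 h2 ϑ).deriv]

/-! ## §2 The radial row: `J(·, ϑ)` is Lipschitz in the level, uniformly in the angle and in the frame -/

/-- **THE RADIAL ROW (pointwise, derivative-free).**  For `ρ, ρ' ∈ (−r, r)` and every angle `ϑ`,
`|J(ρ,ϑ) − J(ρ',ϑ)| ≤ (1/(Dt_min − 2A)² + π√2·(2 + 4A)/(Dt_min − 2A)³)·|ρ − ρ'|`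
(`klrj_jacobian_lipschitz` at `κ₀ = A`, `κ₁ = 2A`, `κ₂ = 4A`: the radius is `1/(Dt−2A)`-Lipschitz in the level, `∂_tε₀` is `2`-Lipschitz and
`Dδ_K[dir]` is `4A`-Lipschitz along the ray, `u ≤ π√2`). -/
theorem abs_levelChartJac_sub_le {ρ ρ' : ℝ} (hρ : ρ ∈ Ioo (-r) r) (hρ' : ρ' ∈ Ioo (-r) r) (ϑ : ℝ) :
    |levelChartJac μ K (ρ, ϑ) - levelChartJac μ K (ρ', ϑ)| ≤
      (1 / (B.Dtmin - 2 * A) ^ 2 + Real.pi * Real.sqrt 2 * (2 + 4 * A) / (B.Dtmin - 2 * A) ^ 3) * |ρ - ρ'| := by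
  have hC : ContDiff ℝ 1 (fun k : Fin 2 → ℝ => -K.eval k) := by
    rw [← frameShift_toLp_eq_neg_eval]; exact contDiff_frameShift_toLp K
  have hδ : ∀ k : Fin 2 → ℝ, (∀ i, |k i| ≤ π) → |(fun q : Fin 2 → ℝ => -K.eval q) k| ≤ A := fun k _ => by
    simpa [frameShift_toLp] using abs_frameShift_toLp_le hA k
  have hκ : ∀ k : Fin 2 → ℝ, (∀ i, |k i| ≤ π) → ‖fderiv ℝ (fun q : Fin 2 → ℝ => -K.eval q) k‖ ≤ 2 * A := fun k _ => by
    rw [← frameShift_toLp_eq_neg_eval]; exact norm_fderiv_frameShift_toLp_le hA k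
  have hA0 : 0 ≤ A := le_trans (norm_nonneg _) (hA 0 0 (by norm_num))
  -- the radial Lipschitz input `κ₂ = 4A` of `Dδ_K[dir ϑ]` along the ray
  have hD2 : ∀ s t : ℝ, s ∈ Icc 0 (π / ‖dir ϑ‖) → t ∈ Icc 0 (π / ‖dir ϑ‖) →
      |fderiv ℝ (fun k : Fin 2 → ℝ => -K.eval k) (s • dir ϑ) (dir ϑ) -
          fderiv ℝ (fun k : Fin 2 → ℝ => -K.eval k) (t • dir ϑ) (dir ϑ)| ≤ 4 * A * |s - t| := by
    intro s t _ _
    rw [← frameShift_toLp_eq_neg_eval]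
    exact klrk_radial_fderiv_lipschitz (contDiff_frameShift_toLp K) (frameShift_toLp_small hA le_rfl).2.2
      (norm_dir_le_one ϑ) s t
  have h1 : a ≤ μ + ρ - A := by have := hρ.1; linarith
  have h2 : μ + ρ + A ≤ b := by have := hρ.2; linarith
  have h1' : a ≤ μ + ρ' - A := by have := hρ'.1; linarith
  have h2' : μ + ρ' + A ≤ b := by have := hρ'.2; linarith
  have h := klrj_jacobian_lipschitz B hC hδ hκ hADt (κ₂ := 4 * A) (by positivity) hD2 h1 h2 h1' h2'
  rw [levelChartJac_eq_radius_mul_inv_slope B hA hADt hlo hhi hρ ϑ,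
    levelChartJac_eq_radius_mul_inv_slope B hA hADt hlo hhi hρ' ϑ]
  simpa [add_sub_add_left_eq_sub] using h

omit hA hlo hhi in
/-- The radial-row constant is positive (`2A < Dt_min`). -/
theorem jacRadialConst_pos (hA0 : 0 ≤ A) :
    0 < 1 / (B.Dtmin - 2 * A) ^ 2 + Real.pi * Real.sqrt 2 * (2 + 4 * A) / (B.Dtmin - 2 * A) ^ 3 := by
  have hd : 0 < B.Dtmin - 2 * A := by linarith
  positivity

/-- **The radial row in DERIVATIVE form**: at every level of the tube, `|∂_ρ J(ρ, ϑ)| ≤ 1/(Dt_min − 2A)² + π√2·(2 + 4A)/(Dt_min − 2A)³`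
(converse mean-value inequality `norm_deriv_le_of_lip'` applied to the Lipschitz row; the `ρ`-derivative exists since `J` is `C^∞` on the tube —
the alternative spelling `|∂_ρ levelChartJac|` of the datum, for consumers differentiating the angular average under the integral sign). -/
theorem abs_deriv_levelChartJac_radial_le {ρ : ℝ} (hρ : ρ ∈ Ioo (-r) r) (ϑ : ℝ) :
    |deriv (fun s : ℝ => levelChartJac μ K (s, ϑ)) ρ| ≤
      1 / (B.Dtmin - 2 * A) ^ 2 + Real.pi * Real.sqrt 2 * (2 + 4 * A) / (B.Dtmin - 2 * A) ^ 3 := by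
  have hA0 : 0 ≤ A := le_trans (norm_nonneg _) (hA 0 0 (by norm_num))
  rw [← Real.norm_eq_abs]
  refine norm_deriv_le_of_lip' (jacRadialConst_pos B hADt hA0).le ?_
  filter_upwards [Ioo_mem_nhds hρ.1 hρ.2] with s hs
  rw [Real.norm_eq_abs, Real.norm_eq_abs]
  exact abs_levelChartJac_sub_le B hA hADt hlo hhi hs hρ ϑ

/-! ## §3 The level density `N_K(ρ) = ∫_{(0,2π]} J(ρ,ϑ) dϑ` is Lipschitz; the odd-difference form `hJ` -/

/-- The angular section `ϑ ↦ J(ρ, ϑ)` at a level of the tube is continuous (the Jacobian weight is `C^∞` on the open tube). -/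
theorem continuous_levelChartJac_angle {ρ : ℝ} (hρ : ρ ∈ Ioo (-r) r) : Continuous fun ϑ : ℝ => levelChartJac μ K (ρ, ϑ) := by
  have hc : ContinuousOn (levelChartJac μ K) ({ρ : ℝ | |ρ| < r} ×ˢ univ) := (contDiffOn_levelChartJac B hA hADt hlo hhi).continuousOn
  have hρ' : |ρ| < r := abs_lt.2 ⟨hρ.1, hρ.2⟩
  exact hc.comp_continuous (continuous_const.prodMk continuous_id) fun ϑ => mk_mem_prod hρ' (mem_univ ϑ)

/-- The angular section is integrable on the angular window `(0, 2π]`. -/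
theorem integrableOn_levelChartJac_angle {ρ : ℝ} (hρ : ρ ∈ Ioo (-r) r) :
    IntegrableOn (fun ϑ : ℝ => levelChartJac μ K (ρ, ϑ)) (Ioc 0 (2 * π)) :=
  (continuous_levelChartJac_angle B hA hADt hlo hhi hρ).integrableOn_Ioc

/-- **The level density is Lipschitz**: for `ρ, ρ' ∈ (−r, r)`,
`|N_K(ρ) − N_K(ρ')| ≤ 2π·(1/(Dt_min − 2A)² + π√2·(2 + 4A)/(Dt_min − 2A)³)·|ρ − ρ'|`, `N_K(ρ) = ∫_{(0,2π]} J(ρ,ϑ) dϑ`. -/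
theorem abs_levelDensity_sub_le {ρ ρ' : ℝ} (hρ : ρ ∈ Ioo (-r) r) (hρ' : ρ' ∈ Ioo (-r) r) :
    |(∫ ϑ in Ioc 0 (2 * π), levelChartJac μ K (ρ, ϑ)) - ∫ ϑ in Ioc 0 (2 * π), levelChartJac μ K (ρ', ϑ)| ≤
      2 * π * ((1 / (B.Dtmin - 2 * A) ^ 2 + Real.pi * Real.sqrt 2 * (2 + 4 * A) / (B.Dtmin - 2 * A) ^ 3) * |ρ - ρ'|) := by
  rw [← integral_sub (integrableOn_levelChartJac_angle B hA hADt hlo hhi hρ) (integrableOn_levelChartJac_angle B hA hADt hlo hhi hρ')]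
  have hvol : volume (Ioc 0 (2 * π)) < ⊤ := by rw [Real.volume_Ioc]; exact ENNReal.ofReal_lt_top
  have h := norm_setIntegral_le_of_norm_le_const hvol (f := fun ϑ => levelChartJac μ K (ρ, ϑ) - levelChartJac μ K (ρ', ϑ))
    (C := (1 / (B.Dtmin - 2 * A) ^ 2 + Real.pi * Real.sqrt 2 * (2 + 4 * A) / (B.Dtmin - 2 * A) ^ 3) * |ρ - ρ'|)
    (fun ϑ _ => by rw [Real.norm_eq_abs]; exact abs_levelChartJac_sub_le B hA hADt hlo hhi hρ hρ' ϑ)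
  rw [Real.norm_eq_abs, Real.volume_real_Ioc_of_le (by positivity)] at h
  calc _ ≤ (1 / (B.Dtmin - 2 * A) ^ 2 + Real.pi * Real.sqrt 2 * (2 + 4 * A) / (B.Dtmin - 2 * A) ^ 3) * |ρ - ρ'| *
        (2 * π - 0) := h
    _ = _ := by ring

/-- **THE RADIAL ROW in the consumer's spelling** — the hypothesis `hJ` of `…C4aTubeTadpoleValue.norm_tubeTadpole_const_le` with
`dJ ρ = 4π·jacR·|ρ|`: for `ρ ∈ (−r, r)`,
`|N_K(ρ) − N_K(−ρ)| ≤ 4π·(1/(Dt_min − 2A)² + π√2·(2 + 4A)/(Dt_min − 2A)³)·|ρ|`. -/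
theorem abs_levelDensity_sub_neg_le :
    ∀ ρ ∈ Ioo (-r) r,
      |(∫ ϑ in Ioc 0 (2 * π), levelChartJac μ K (ρ, ϑ)) - ∫ ϑ in Ioc 0 (2 * π), levelChartJac μ K (-ρ, ϑ)| ≤
        4 * π * (1 / (B.Dtmin - 2 * A) ^ 2 + Real.pi * Real.sqrt 2 * (2 + 4 * A) / (B.Dtmin - 2 * A) ^ 3) * |ρ| := by
  intro ρ hρ
  have hρ' : -ρ ∈ Ioo (-r) r := ⟨by linarith [hρ.2], by linarith [hρ.1]⟩
  have h := abs_levelDensity_sub_le B hA hADt hlo hhi hρ hρ'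
  have h2 : |ρ - -ρ| = 2 * |ρ| := by rw [sub_neg_eq_add, ← two_mul, abs_mul, abs_two]
  rw [h2] at h
  linarith

/-! ## §4 Angular averages against a vertex: the JACOBIAN HALF of the (L3-val) dominator -/

/-- The chart-side integrand `ϑ ↦ J(s,ϑ) • V(Φ(0,θ), Φ(s,ϑ))` of an angular average is continuous on a level circle of the tube. -/
theorem continuous_jac_smul_vertex_angle {V : Momentum → Momentum → ℂ} (hV : ContDiff ℝ ∞ fun x : Momentum × Momentum => V x.1 x.2)
    (θ : ℝ) {s : ℝ} (hs : s ∈ Ioo (-r) r) :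
    Continuous fun ϑ : ℝ => levelChartJac μ K (s, ϑ) • V (levelPoint μ K 0 θ) (levelPoint μ K s ϑ) := by
  have hs' : |s| < r := abs_lt.2 ⟨hs.1, hs.2⟩
  have hg : ContinuousOn (fun p : ℝ × ℝ => V (levelPoint μ K 0 θ) (levelPoint μ K p.1 p.2)) ({ρ : ℝ | |ρ| < r} ×ˢ univ) :=
    (contDiffOn_vertex_chart B hA hADt hlo hhi hV θ).continuousOn
  have hf : Continuous fun ϑ : ℝ => ((s, ϑ) : ℝ × ℝ) := continuous_const.prodMk continuous_id
  have hVc : Continuous ((fun p : ℝ × ℝ => V (levelPoint μ K 0 θ) (levelPoint μ K p.1 p.2)) ∘ fun ϑ : ℝ => ((s, ϑ) : ℝ × ℝ)) :=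
    hg.comp_continuous hf fun ϑ => mk_mem_prod hs' (mem_univ ϑ)
  exact (continuous_levelChartJac_angle B hA hADt hlo hhi hs).smul (hVc.congr fun _ => rfl)

/-- **Odd-difference of angular averages — the Jacobian half of (L3-val).**  For two jointly smooth vertices `Vp, Vm` (the fat vertex at the
Matsubara pair `±q₀`; `Vp = Vm` for a single profile), read from the curve point `Φ(0,θ)`: if on the level-`ρ` circle `‖Vp(Φ(0,θ), Φ(ρ,ϑ))‖ ≤ M` and the
VERTEX odd-difference along the chart is dominated, `‖Vp(Φ(0,θ), Φ(ρ,ϑ)) − Vm(Φ(0,θ), Φ(−ρ,ϑ))‖ ≤ e(ϑ)` with `e` integrable on `(0, 2π]`, then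
`‖∫ J(ρ,ϑ)•Vp(…Φ(ρ,ϑ)) dϑ − ∫ J(−ρ,ϑ)•Vm(…Φ(−ρ,ϑ)) dϑ‖ ≤ 4π·jacR·|ρ|·M + (π√2/(Dt_min − 2A))·∫_{(0,2π]} e`
(`J(ρ)•Vp − J(−ρ)•Vm = (J(ρ) − J(−ρ))•Vp + J(−ρ)•(Vp − Vm)`, the radial row for the first term, `0 < J ≤ π√2/(Dt_min − 2A)` for the second).
What (L3-val) must still supply is ONLY the vertex's own radial odd-difference `e` (C4A-PLAN §17.3); the Jacobian's share is this file's row. -/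
theorem norm_setIntegral_jac_smul_sub_le {Vp Vm : Momentum → Momentum → ℂ}
    (hVp : ContDiff ℝ ∞ fun x : Momentum × Momentum => Vp x.1 x.2) (hVm : ContDiff ℝ ∞ fun x : Momentum × Momentum => Vm x.1 x.2)
    (θ : ℝ) {ρ : ℝ} (hρ : ρ ∈ Ioo (-r) r) {M : ℝ}
    (hM : ∀ ϑ ∈ Ioc 0 (2 * π), ‖Vp (levelPoint μ K 0 θ) (levelPoint μ K ρ ϑ)‖ ≤ M) {e : ℝ → ℝ}
    (he : ∀ ϑ ∈ Ioc 0 (2 * π),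
      ‖Vp (levelPoint μ K 0 θ) (levelPoint μ K ρ ϑ) - Vm (levelPoint μ K 0 θ) (levelPoint μ K (-ρ) ϑ)‖ ≤ e ϑ)
    (heI : IntegrableOn e (Ioc 0 (2 * π))) :
    ‖(∫ ϑ in Ioc 0 (2 * π), levelChartJac μ K (ρ, ϑ) • Vp (levelPoint μ K 0 θ) (levelPoint μ K ρ ϑ)) -
        ∫ ϑ in Ioc 0 (2 * π), levelChartJac μ K (-ρ, ϑ) • Vm (levelPoint μ K 0 θ) (levelPoint μ K (-ρ) ϑ)‖ ≤
      4 * π * (1 / (B.Dtmin - 2 * A) ^ 2 + Real.pi * Real.sqrt 2 * (2 + 4 * A) / (B.Dtmin - 2 * A) ^ 3) * |ρ| * M +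
        Real.pi * Real.sqrt 2 / (B.Dtmin - 2 * A) * ∫ ϑ in Ioc 0 (2 * π), e ϑ := by
  set C := 1 / (B.Dtmin - 2 * A) ^ 2 + Real.pi * Real.sqrt 2 * (2 + 4 * A) / (B.Dtmin - 2 * A) ^ 3 with hCdef
  set Jmax := Real.pi * Real.sqrt 2 / (B.Dtmin - 2 * A) with hJmax
  have hA0 : 0 ≤ A := le_trans (norm_nonneg _) (hA 0 0 (by norm_num))
  have hC0 : 0 < C := jacRadialConst_pos B hADt hA0
  have hρ' : -ρ ∈ Ioo (-r) r := ⟨by linarith [hρ.2], by linarith [hρ.1]⟩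
  -- integrability of the two integrands (continuous on the level circle)
  have hIp := (continuous_jac_smul_vertex_angle B hA hADt hlo hhi hVp θ hρ).integrableOn_Ioc (μ := volume) (a := 0) (b := 2 * π)
  have hIm := (continuous_jac_smul_vertex_angle B hA hADt hlo hhi hVm θ hρ').integrableOn_Ioc (μ := volume) (a := 0) (b := 2 * π)
  rw [← integral_sub hIp hIm]
  -- the Jacobian at level −ρ: 0 < J ≤ Jmax
  have hJ : ∀ ϑ : ℝ, |levelChartJac μ K (-ρ, ϑ)| ≤ Jmax := by
    intro ϑ
    have h1 : a < μ + (-ρ) - A := by have := hρ'.1; linarith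
    have h2 : μ + (-ρ) + A < b := by have := hρ'.2; linarith
    rw [levelChartJac_apply, abs_of_pos (levelChartJac_pos B hA hADt (p := (-ρ, ϑ)) h1 h2)]
    exact levelChartJac_le B hA hADt (p := (-ρ, ϑ)) h1 h2
  -- pointwise bound by an integrable dominator
  have hvol : volume (Ioc 0 (2 * π)) < ⊤ := by rw [Real.volume_Ioc]; exact ENNReal.ofReal_lt_top
  have hgI : IntegrableOn (fun ϑ : ℝ => 2 * C * |ρ| * M + Jmax * e ϑ) (Ioc 0 (2 * π)) :=
    (integrableOn_const (C := 2 * C * |ρ| * M) hvol.ne).add (heI.const_mul Jmax)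
  have hpt : ∀ᵐ ϑ ∂(volume.restrict (Ioc 0 (2 * π))),
      ‖levelChartJac μ K (ρ, ϑ) • Vp (levelPoint μ K 0 θ) (levelPoint μ K ρ ϑ) -
          levelChartJac μ K (-ρ, ϑ) • Vm (levelPoint μ K 0 θ) (levelPoint μ K (-ρ) ϑ)‖ ≤ 2 * C * |ρ| * M + Jmax * e ϑ := by
    refine (ae_restrict_iff' measurableSet_Ioc).2 (Filter.Eventually.of_forall fun ϑ hϑ => ?_)
    have hsplit : levelChartJac μ K (ρ, ϑ) • Vp (levelPoint μ K 0 θ) (levelPoint μ K ρ ϑ) -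
        levelChartJac μ K (-ρ, ϑ) • Vm (levelPoint μ K 0 θ) (levelPoint μ K (-ρ) ϑ) =
      (levelChartJac μ K (ρ, ϑ) - levelChartJac μ K (-ρ, ϑ)) • Vp (levelPoint μ K 0 θ) (levelPoint μ K ρ ϑ) +
        levelChartJac μ K (-ρ, ϑ) • (Vp (levelPoint μ K 0 θ) (levelPoint μ K ρ ϑ) -
          Vm (levelPoint μ K 0 θ) (levelPoint μ K (-ρ) ϑ)) := by
      rw [sub_smul, smul_sub]; abel
    rw [hsplit]
    have hd : |levelChartJac μ K (ρ, ϑ) - levelChartJac μ K (-ρ, ϑ)| ≤ 2 * C * |ρ| := by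
      have h := abs_levelChartJac_sub_le B hA hADt hlo hhi hρ hρ' ϑ
      have h2 : |ρ - -ρ| = 2 * |ρ| := by rw [sub_neg_eq_add, ← two_mul, abs_mul, abs_two]
      rw [h2] at h
      linarith
    calc _ ≤ ‖(levelChartJac μ K (ρ, ϑ) - levelChartJac μ K (-ρ, ϑ)) • Vp (levelPoint μ K 0 θ) (levelPoint μ K ρ ϑ)‖ +
          ‖levelChartJac μ K (-ρ, ϑ) • (Vp (levelPoint μ K 0 θ) (levelPoint μ K ρ ϑ) -
            Vm (levelPoint μ K 0 θ) (levelPoint μ K (-ρ) ϑ))‖ := norm_add_le _ _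
      _ ≤ 2 * C * |ρ| * M + Jmax * e ϑ := by
          rw [norm_smul, norm_smul, Real.norm_eq_abs, Real.norm_eq_abs]
          exact add_le_add (mul_le_mul hd (hM ϑ hϑ) (norm_nonneg _) (by positivity))
            (mul_le_mul (hJ ϑ) (he ϑ hϑ) (norm_nonneg _) ((abs_nonneg _).trans (hJ ϑ)))
  refine (norm_integral_le_of_norm_le hgI hpt).trans (le_of_eq ?_)
  have hcI : IntegrableOn (fun _ : ℝ => 2 * C * |ρ| * M) (Ioc 0 (2 * π)) := integrableOn_const hvol.ne
  have heJ : IntegrableOn (fun ϑ : ℝ => Jmax * e ϑ) (Ioc 0 (2 * π)) := heI.const_mul Jmax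
  rw [integral_add hcI heJ, setIntegral_const, integral_const_mul, Real.volume_real_Ioc_of_le (by positivity), smul_eq_mul]
  ring

end Radial

end Summit.HubbardSuperconductivity.HubbardSuperconductivity.Theorems.C4a

end
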